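import Literature.Topology.FourManifolds.ResolutionNeckPiece
import Literature.Geometry.Manifold.FibrewiseReparam
import HarnessLib

/-!
# Fibre profiles of the far pieces of the tube of `Σ̄₂`

Topic `Literature/Topology/FourManifolds` (fact seat of the Seiberg–Witten leaf
`Literature.Barriers.SmoothPoincare4.akhmedovPark2010_lemma8_invariants`; block 2 of
Akhmedov–Park's `X₁(m)`, A. Akhmedov, B. D. Park, Invent. Math. 181 (2010), §3).  Away from the
resolution neck and the blow-up caps, the tube of the genus-2 surface `Σ̄₂ ⊂ T⁴ # ℂℙ²bar` is the
product tube `T : F × ℝ² → X` of one of the two sheets with its fibre REPARAMETRISED,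
`(p, ṽ) ↦ T (p, Θ (p, ṽ))`, by one of two profiles (`m : F → ℂ` a smooth nonvanishing
multiplier — the framing function times a radial factor — and `ℝ² ≅ ℂ` through `cx`, `vc`):

* the LINEAR profile `Θ (p, ṽ) = vc (m p · cx ṽ)` (first sheet, §1);
* the THIN-ARC profile `Θ (p, ṽ) = R (m p · cx ṽ)`,
  `R s = (tan (arctan (Re s) / δ), tan (arctan (Im s) / δ))`, the inverse of the thin-arc
  coordinate `r u = (tan (δ arctan u₀), tan (δ arctan u₁))` of the braided second sheet
  (`BraidedTorusSheet.lean`), on `W = {‖m p · cx ṽ‖ < s₀}`, `arctan s₀ < δ π / 2` (§2).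

For each we verify the four identities of `FibrewiseReparam.lean` with the explicit fibrewise
inverse `Λ` and conclude: the far piece is smooth, injective, open on open subsets and has a smooth
left inverse on its image, together with the coordinate identities `cx (Θ q) = m q.1 · cx q.2`
resp. `r (Θ q) = m q.1 · cx q.2` through which the plumbing coordinates of the far pieces are
read.  Everything is proved; no definitions (maps bound by hypotheses).

## References

* A. Akhmedov, B. D. Park, Invent. Math. 181 (2010) 577–603 = arXiv:math/0701829, §3. [AkhmedovPark2010]
* J. M. Lee, *Introduction to Smooth Manifolds*, 2nd ed. (2013), Prop. 5.2. [LeeSmoothManifolds2013]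
-/

noncomputable section

open scoped Manifold ContDiff Topology Real
open Set Function Complex
open Literature.Geometry.Manifold

namespace Literature.Topology.FourManifolds

namespace FibreProfile

variable {F : Type} [TopologicalSpace F] [ChartedSpace (EuclideanSpace ℝ (Fin 2)) F]
  {X : Type} [TopologicalSpace X] [ChartedSpace (EuclideanSpace ℝ (Fin 4)) X]
  {cx : EuclideanSpace ℝ (Fin 2) → ℂ} {vc : ℂ → EuclideanSpace ℝ (Fin 2)}
  {T : F × EuclideanSpace ℝ (Fin 2) → X} {m : F → ℂ} {O : Set F}

variable (hcx : ∀ v, cx v = ⟨v 0, v 1⟩)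
  (hvc : ∀ z, vc z = z.re • EuclideanSpace.single 0 (1 : ℝ) + z.im • EuclideanSpace.single 1 (1 : ℝ))
  (hT : Manifold.IsSmoothEmbedding ((𝓡 2).prod (𝓡 2)) (𝓡 4) ∞ T) (hTo : IsOpen (range T))
  (hO : IsOpen O) (hm : ContMDiffOn (𝓡 2) 𝓘(ℝ, ℂ) ∞ m O) (hm0 : ∀ p ∈ O, m p ≠ 0)

/-! ### §0 Smoothness helpers -/

omit [ChartedSpace (EuclideanSpace ℝ (Fin 2)) F] in
include hm0 in
/-- `m⁻¹` is smooth on `O`. [folklore] -/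
theorem contMDiffOn_inv [ChartedSpace (EuclideanSpace ℝ (Fin 2)) F]
    (hm : ContMDiffOn (𝓡 2) 𝓘(ℝ, ℂ) ∞ m O) :
    ContMDiffOn (𝓡 2) 𝓘(ℝ, ℂ) ∞ (fun p => (m p)⁻¹) O := fun p hp =>
  ((contDiffAt_inv ℝ (hm0 p hp)).contMDiffAt).comp_contMDiffWithinAt p (hm p hp)

include hcx in
/-- Smoothness of `(p, ṽ) ↦ g p · cx ṽ` on `O × ℝ²` for `g` smooth on `O`. [folklore] -/
theorem contMDiffOn_mul_cx {g : F → ℂ} (hg : ContMDiffOn (𝓡 2) 𝓘(ℝ, ℂ) ∞ g O) :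
    ContMDiffOn ((𝓡 2).prod (𝓡 2)) 𝓘(ℝ, ℂ) ∞
      (fun q : F × EuclideanSpace ℝ (Fin 2) => g q.1 * cx q.2) (O ×ˢ (univ : Set _)) := by
  have h1 : ContMDiffOn ((𝓡 2).prod (𝓡 2)) 𝓘(ℝ, ℂ) ∞
      (fun q : F × EuclideanSpace ℝ (Fin 2) => g q.1) (O ×ˢ (univ : Set _)) :=
    hg.comp contMDiffOn_fst fun q hq => hq.1
  have h2 : ContMDiff ((𝓡 2).prod (𝓡 2)) 𝓘(ℝ, ℂ) ∞
      (fun q : F × EuclideanSpace ℝ (Fin 2) => cx q.2) :=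
    (NeckPiece.contMDiff_cx hcx).comp contMDiff_snd
  exact (contDiff_mul (𝕜 := ℝ) (𝔸 := ℂ)).contMDiff.comp_contMDiffOn (h1.prodMk_space h2.contMDiffOn)

include hcx hvc in
/-- Smoothness of a fibre map `(p, ṽ) ↦ vc (g p · cx ṽ)` for `g` smooth on `O`. [folklore] -/
theorem contMDiffOn_vc_mul_cx {g : F → ℂ} (hg : ContMDiffOn (𝓡 2) 𝓘(ℝ, ℂ) ∞ g O) :
    ContMDiffOn ((𝓡 2).prod (𝓡 2)) (𝓡 2) ∞
      (fun q : F × EuclideanSpace ℝ (Fin 2) => vc (g q.1 * cx q.2)) (O ×ˢ (univ : Set _)) :=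
  (NeckPiece.contMDiff_vc hvc).comp_contMDiffOn (contMDiffOn_mul_cx hcx hg)

include hvc in
/-- `vc 0 = 0`. [folklore] -/
theorem vc_zero : vc 0 = 0 := by
  rw [hvc]; simp

/-! ### §1 The linear profile -/

section Linear

variable {Θ Λ : F × EuclideanSpace ℝ (Fin 2) → EuclideanSpace ℝ (Fin 2)}
  (hΘ : ∀ q, Θ q = vc (m q.1 * cx q.2)) (hΛ : ∀ q, Λ q = vc ((m q.1)⁻¹ * cx q.2))

omit [TopologicalSpace F] [ChartedSpace (EuclideanSpace ℝ (Fin 2)) F] in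
include hcx hvc hm0 hΘ hΛ in
/-- The four reparametrisation identities of the linear profile on `W = W′ = O × ℝ²`. [folklore] -/
theorem linear_identities :
    (∀ q ∈ O ×ˢ (univ : Set (EuclideanSpace ℝ (Fin 2))), (q.1, Θ q) ∈ O ×ˢ (univ : Set _)) ∧
    (∀ q ∈ O ×ˢ (univ : Set (EuclideanSpace ℝ (Fin 2))), Λ (q.1, Θ q) = q.2) ∧
    (∀ q ∈ O ×ˢ (univ : Set (EuclideanSpace ℝ (Fin 2))), (q.1, Λ q) ∈ O ×ˢ (univ : Set _)) ∧
    (∀ q ∈ O ×ˢ (univ : Set (EuclideanSpace ℝ (Fin 2))), Θ (q.1, Λ q) = q.2) := by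
  refine ⟨fun q hq => ⟨hq.1, mem_univ _⟩, fun q hq => ?_, fun q hq => ⟨hq.1, mem_univ _⟩,
    fun q hq => ?_⟩
  · rw [hΛ, hΘ]
    simp only
    rw [NeckPiece.cx_vc hcx hvc, ← mul_assoc, inv_mul_cancel₀ (hm0 _ hq.1), one_mul,
      NeckPiece.vc_cx hcx hvc]
  · rw [hΘ, hΛ]
    simp only
    rw [NeckPiece.cx_vc hcx hvc, ← mul_assoc, mul_inv_cancel₀ (hm0 _ hq.1), one_mul,
      NeckPiece.vc_cx hcx hvc]

omit [TopologicalSpace F] [ChartedSpace (EuclideanSpace ℝ (Fin 2)) F] in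
include hcx hvc hΘ in
/-- **Coordinate identity of the linear profile**: `cx (Θ q) = m q.1 · cx q.2`, and `Θ (p, 0) = 0`. [folklore] -/
theorem cx_linearTheta (q : F × EuclideanSpace ℝ (Fin 2)) (p : F) :
    cx (Θ q) = m q.1 * cx q.2 ∧ Θ (p, 0) = 0 := by
  constructor
  · rw [hΘ, NeckPiece.cx_vc hcx hvc]
  · have h0 : m p * cx 0 = 0 := by
      rw [mul_eq_zero]; right; rw [hcx]; apply Complex.ext <;> simp
    rw [hΘ]
    simp only
    rw [h0, vc_zero hvc]

include hcx hvc hm hΘ in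
/-- The linear profile is smooth on `O × ℝ²`. [folklore] -/
theorem contMDiffOn_linearTheta :
    ContMDiffOn ((𝓡 2).prod (𝓡 2)) (𝓡 2) ∞ Θ (O ×ˢ (univ : Set _)) := by
  have : Θ = fun q => vc (m q.1 * cx q.2) := funext hΘ
  rw [this]; exact contMDiffOn_vc_mul_cx hcx hvc hm

include hcx hvc hm hm0 hΛ in
/-- The inverse linear profile is smooth on `O × ℝ²`. [folklore] -/
theorem contMDiffOn_linearLambda :
    ContMDiffOn ((𝓡 2).prod (𝓡 2)) (𝓡 2) ∞ Λ (O ×ˢ (univ : Set _)) := by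
  have : Λ = fun q => vc ((m q.1)⁻¹ * cx q.2) := funext hΛ
  rw [this]; exact contMDiffOn_vc_mul_cx hcx hvc (contMDiffOn_inv hm0 hm)

include hcx hvc hT hm hΘ in
/-- **The linear far piece `(p, ṽ) ↦ T (p, vc (m p · cx ṽ))` is smooth on `O × ℝ²`.** [folklore] -/
theorem contMDiffOn_linearFar :
    ContMDiffOn ((𝓡 2).prod (𝓡 2)) (𝓡 4) ∞
      (fun q : F × EuclideanSpace ℝ (Fin 2) => T (q.1, Θ q)) (O ×ˢ (univ : Set _)) :=
  Reparam.contMDiffOn_reparam hT (contMDiffOn_linearTheta hcx hvc hm hΘ)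

include hcx hvc hT hm0 hΘ hΛ in
/-- The linear far piece is injective on `O × ℝ²`. [folklore] -/
theorem injOn_linearFar :
    InjOn (fun q : F × EuclideanSpace ℝ (Fin 2) => T (q.1, Θ q)) (O ×ˢ (univ : Set _)) :=
  Reparam.injOn_reparam hT.isEmbedding.injective (linear_identities hcx hvc hm0 hΘ hΛ).2.1

include hcx hvc hT hTo hO hm hm0 hΘ hΛ in
/-- The linear far piece maps open subsets of `O × ℝ²` to open sets. [folklore] -/
theorem isOpen_image_linearFar {Oq : Set (F × EuclideanSpace ℝ (Fin 2))} (hOq : IsOpen Oq)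
    (hOqW : Oq ⊆ O ×ˢ (univ : Set _)) :
    IsOpen ((fun q : F × EuclideanSpace ℝ (Fin 2) => T (q.1, Θ q)) '' Oq) := by
  obtain ⟨hΘW, hΛΘ, -, hΘΛ⟩ := linear_identities hcx hvc hm0 hΘ hΛ
  exact Reparam.isOpen_image_reparam hT hTo (hO.prod isOpen_univ)
    (contMDiffOn_linearLambda hcx hvc hm hm0 hΛ) hΘW hΛΘ hΘΛ hOq hOqW

include hcx hvc hT hm hm0 hΘ hΛ in
/-- The linear far piece has a smooth left inverse on its image. [folklore] -/
theorem exists_inverse_linearFar [Nonempty F] :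
    ∃ Rinv : X → F × EuclideanSpace ℝ (Fin 2),
      ContMDiffOn (𝓡 4) ((𝓡 2).prod (𝓡 2)) ∞ Rinv
        ((fun q : F × EuclideanSpace ℝ (Fin 2) => T (q.1, Θ q)) '' (O ×ˢ (univ : Set _))) ∧
      ∀ q ∈ O ×ˢ (univ : Set (EuclideanSpace ℝ (Fin 2))), Rinv (T (q.1, Θ q)) = q := by
  obtain ⟨hΘW, hΛΘ, -, -⟩ := linear_identities hcx hvc hm0 hΘ hΛ
  exact Reparam.exists_inverse_reparam hT (contMDiffOn_linearLambda hcx hvc hm hm0 hΛ) hΘW hΛΘ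

end Linear

/-! ### §2 The thin-arc profile -/

section Arc

variable {δ s₀ : ℝ} {R : ℂ → EuclideanSpace ℝ (Fin 2)} {rc : EuclideanSpace ℝ (Fin 2) → ℂ}
  {Θ Λ : F × EuclideanSpace ℝ (Fin 2) → EuclideanSpace ℝ (Fin 2)}
  (hδ : 0 < δ) (hδ1 : δ ≤ 1) (hs₀ : Real.arctan s₀ < δ * (π / 2))
  (hR : ∀ s, R s = Real.tan (Real.arctan s.re / δ) • EuclideanSpace.single 0 (1 : ℝ) +
    Real.tan (Real.arctan s.im / δ) • EuclideanSpace.single 1 (1 : ℝ))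
  (hrc : ∀ u, rc u = ⟨Real.tan (δ * Real.arctan (u 0)), Real.tan (δ * Real.arctan (u 1))⟩)
  (hΘ : ∀ q, Θ q = R (m q.1 * cx q.2)) (hΛ : ∀ q, Λ q = vc ((m q.1)⁻¹ * rc q.2))

include hδ hs₀ in
/-- For `|x| < s₀`: `|arctan x / δ| < π/2`, hence `cos (arctan x / δ) > 0` and the thin-arc
coordinate inverts `R`: `tan (δ arctan (tan (arctan x / δ))) = x`. [folklore] -/
theorem arc_inverse_facts {x : ℝ} (hx : |x| < s₀) :
    |Real.arctan x / δ| < π / 2 ∧ 0 < Real.cos (Real.arctan x / δ) ∧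
      Real.tan (δ * Real.arctan (Real.tan (Real.arctan x / δ))) = x := by
  have hx' := abs_lt.1 hx
  have h1 : Real.arctan x < Real.arctan s₀ := Real.arctan_strictMono hx'.2
  have h2 : Real.arctan (-s₀) < Real.arctan x := Real.arctan_strictMono hx'.1
  rw [Real.arctan_neg] at h2
  have habs : |Real.arctan x / δ| < π / 2 := by
    rw [abs_div, abs_of_pos hδ, div_lt_iff₀ hδ]
    have : |Real.arctan x| < Real.arctan s₀ := abs_lt.2 ⟨by linarith, h1⟩
    linarith
  have hlt := abs_lt.1 habs
  have hcos : 0 < Real.cos (Real.arctan x / δ) := Real.cos_pos_of_mem_Ioo ⟨by linarith, hlt.2⟩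
  refine ⟨habs, hcos, ?_⟩
  rw [Real.arctan_tan (by linarith) hlt.2, mul_div_cancel₀ _ hδ.ne', Real.tan_arctan]

include hδ hδ1 in
/-- For every `u`: `|δ arctan u| < π/2`, `cos (δ arctan u) > 0`, and
`tan (arctan (tan (δ arctan u)) / δ) = u`. [folklore] -/
theorem arc_forward_facts (u : ℝ) :
    |δ * Real.arctan u| < π / 2 ∧ 0 < Real.cos (δ * Real.arctan u) ∧
      Real.tan (Real.arctan (Real.tan (δ * Real.arctan u)) / δ) = u := by
  have h1 := Real.arctan_lt_pi_div_two u
  have h2 := Real.neg_pi_div_two_lt_arctan u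
  have hπ := Real.pi_pos
  have habs : |δ * Real.arctan u| < π / 2 := by
    rw [abs_mul, abs_of_pos hδ]
    have : |Real.arctan u| < π / 2 := abs_lt.2 ⟨h2, h1⟩
    nlinarith [abs_nonneg (Real.arctan u)]
  have hlt := abs_lt.1 habs
  refine ⟨habs, Real.cos_pos_of_mem_Ioo ⟨by linarith, hlt.2⟩, ?_⟩
  rw [Real.arctan_tan (by linarith) hlt.2, mul_div_cancel_left₀ _ hδ.ne', Real.tan_arctan]

include hrc hδ hδ1 in
/-- The thin-arc coordinate `rc` is smooth. [folklore] -/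
theorem contMDiff_rc : ContMDiff (𝓡 2) 𝓘(ℝ, ℂ) ∞ rc := by
  have hproj : ∀ i : Fin 2, ContMDiff (𝓡 2) 𝓘(ℝ, ℝ) ∞ (fun u : EuclideanSpace ℝ (Fin 2) => u i) :=
    fun i => (EuclideanSpace.proj (𝕜 := ℝ) (ι := Fin 2) i).contMDiff
  have hcomp : ∀ i : Fin 2, ContMDiff (𝓡 2) 𝓘(ℝ, ℝ) ∞
      (fun u : EuclideanSpace ℝ (Fin 2) => Real.tan (δ * Real.arctan (u i))) := fun i u => by
    have hcos := (arc_forward_facts hδ hδ1 (u i)).2.1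
    have h1 : ContMDiffAt (𝓡 2) 𝓘(ℝ, ℝ) ∞ (fun u : EuclideanSpace ℝ (Fin 2) => δ * Real.arctan (u i)) u :=
      (contMDiff_const.mul (Real.contDiff_arctan.contMDiff.comp (hproj i))) u
    have hg : ContDiffAt ℝ ∞ Real.tan (δ * Real.arctan (u i)) := Real.contDiffAt_tan.2 hcos.ne'
    exact hg.contMDiffAt.comp (f := fun u : EuclideanSpace ℝ (Fin 2) => δ * Real.arctan (u i)) u h1
  have heq : rc = fun u => Complex.equivRealProdCLM.symm
      (Real.tan (δ * Real.arctan (u 0)), Real.tan (δ * Real.arctan (u 1))) := by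
    funext u; rw [hrc]; rfl
  rw [heq]
  exact Complex.equivRealProdCLM.symm.contDiff.comp_contMDiff ((hcomp 0).prodMk_space (hcomp 1))

include hR hδ hs₀ in
/-- `R` is smooth at every `s` with `‖s‖ < s₀`. [folklore] -/
theorem contDiffAt_R {s : ℂ} (hs : ‖s‖ < s₀) : ContDiffAt ℝ ∞ R s := by
  have hre : |s.re| < s₀ := lt_of_le_of_lt (Complex.abs_re_le_norm s) hs
  have him : |s.im| < s₀ := lt_of_le_of_lt (Complex.abs_im_le_norm s) hs
  have ha1 : ContDiffAt ℝ ∞ (fun s : ℂ => Real.arctan s.re / δ) s :=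
    (Real.contDiff_arctan.contDiffAt.comp s Complex.reCLM.contDiff.contDiffAt).div_const δ
  have ha2 : ContDiffAt ℝ ∞ (fun s : ℂ => Real.arctan s.im / δ) s :=
    (Real.contDiff_arctan.contDiffAt.comp s Complex.imCLM.contDiff.contDiffAt).div_const δ
  have hg1 : ContDiffAt ℝ ∞ Real.tan (Real.arctan s.re / δ) :=
    Real.contDiffAt_tan.2 (arc_inverse_facts hδ hs₀ hre).2.1.ne'
  have hg2 : ContDiffAt ℝ ∞ Real.tan (Real.arctan s.im / δ) :=
    Real.contDiffAt_tan.2 (arc_inverse_facts hδ hs₀ him).2.1.ne'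
  have h1 : ContDiffAt ℝ ∞ (fun s : ℂ => Real.tan (Real.arctan s.re / δ)) s :=
    hg1.comp (f := fun s : ℂ => Real.arctan s.re / δ) s ha1
  have h2 : ContDiffAt ℝ ∞ (fun s : ℂ => Real.tan (Real.arctan s.im / δ)) s :=
    hg2.comp (f := fun s : ℂ => Real.arctan s.im / δ) s ha2
  have heq : R = fun s : ℂ => Real.tan (Real.arctan s.re / δ) • EuclideanSpace.single 0 (1 : ℝ) +
      Real.tan (Real.arctan s.im / δ) • EuclideanSpace.single 1 (1 : ℝ) := funext hR
  rw [heq]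
  exact (h1.smul contDiffAt_const).add (h2.smul contDiffAt_const)

omit [TopologicalSpace F] [ChartedSpace (EuclideanSpace ℝ (Fin 2)) F] in
include hR hrc hδ hs₀ in
/-- `rc (R s) = s` for `‖s‖ < s₀`. [folklore] -/
theorem rc_R {s : ℂ} (hs : ‖s‖ < s₀) : rc (R s) = s := by
  have hre : |s.re| < s₀ := lt_of_le_of_lt (Complex.abs_re_le_norm s) hs
  have him : |s.im| < s₀ := lt_of_le_of_lt (Complex.abs_im_le_norm s) hs
  have e0 : R s 0 = Real.tan (Real.arctan s.re / δ) := by rw [hR]; simp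
  have e1 : R s 1 = Real.tan (Real.arctan s.im / δ) := by rw [hR]; simp
  rw [hrc, e0, e1, (arc_inverse_facts hδ hs₀ hre).2.2, (arc_inverse_facts hδ hs₀ him).2.2]

omit [TopologicalSpace F] [ChartedSpace (EuclideanSpace ℝ (Fin 2)) F] in
include hR hrc hδ hδ1 in
/-- `R (rc u) = u` for every `u`. [folklore] -/
theorem R_rc (u : EuclideanSpace ℝ (Fin 2)) : R (rc u) = u := by
  have e0 : (rc u).re = Real.tan (δ * Real.arctan (u 0)) := by rw [hrc]
  have e1 : (rc u).im = Real.tan (δ * Real.arctan (u 1)) := by rw [hrc]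
  rw [hR, e0, e1, (arc_forward_facts hδ hδ1 (u 0)).2.2, (arc_forward_facts hδ hδ1 (u 1)).2.2]
  ext i
  fin_cases i <;> simp

omit [TopologicalSpace F] [ChartedSpace (EuclideanSpace ℝ (Fin 2)) F] in
include hcx hvc hm0 hR hrc hδ hδ1 hs₀ hΘ hΛ in
/-- The four reparametrisation identities of the thin-arc profile on
`W = {q | q.1 ∈ O, ‖m q.1 · cx q.2‖ < s₀}`, `W′ = {q | q.1 ∈ O, ‖rc q.2‖ < s₀}`. [folklore] -/
theorem arc_identities :
    (∀ q ∈ {q : F × EuclideanSpace ℝ (Fin 2) | q.1 ∈ O ∧ ‖m q.1 * cx q.2‖ < s₀},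
      (q.1, Θ q) ∈ {q : F × EuclideanSpace ℝ (Fin 2) | q.1 ∈ O ∧ ‖rc q.2‖ < s₀}) ∧
    (∀ q ∈ {q : F × EuclideanSpace ℝ (Fin 2) | q.1 ∈ O ∧ ‖m q.1 * cx q.2‖ < s₀},
      Λ (q.1, Θ q) = q.2) ∧
    (∀ q ∈ {q : F × EuclideanSpace ℝ (Fin 2) | q.1 ∈ O ∧ ‖rc q.2‖ < s₀},
      (q.1, Λ q) ∈ {q : F × EuclideanSpace ℝ (Fin 2) | q.1 ∈ O ∧ ‖m q.1 * cx q.2‖ < s₀}) ∧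
    (∀ q ∈ {q : F × EuclideanSpace ℝ (Fin 2) | q.1 ∈ O ∧ ‖rc q.2‖ < s₀},
      Θ (q.1, Λ q) = q.2) := by
  refine ⟨fun q hq => ⟨hq.1, ?_⟩, fun q hq => ?_, fun q hq => ⟨hq.1, ?_⟩, fun q hq => ?_⟩
  · show ‖rc (Θ q)‖ < s₀
    rw [hΘ, rc_R hδ hs₀ hR hrc hq.2]; exact hq.2
  · rw [hΛ, hΘ]
    simp only
    rw [rc_R hδ hs₀ hR hrc hq.2, ← mul_assoc, inv_mul_cancel₀ (hm0 _ hq.1), one_mul,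
      NeckPiece.vc_cx hcx hvc]
  · show ‖m q.1 * cx (Λ q)‖ < s₀
    rw [hΛ, NeckPiece.cx_vc hcx hvc, ← mul_assoc, mul_inv_cancel₀ (hm0 _ hq.1), one_mul]
    exact hq.2
  · rw [hΘ, hΛ]
    simp only
    rw [NeckPiece.cx_vc hcx hvc, ← mul_assoc, mul_inv_cancel₀ (hm0 _ hq.1), one_mul,
      R_rc hδ hδ1 hR hrc]

omit [TopologicalSpace F] [ChartedSpace (EuclideanSpace ℝ (Fin 2)) F] in
include hcx hR hrc hδ hs₀ hΘ in
/-- **Coordinate identity of the thin-arc profile**: `rc (Θ q) = m q.1 · cx q.2` on `W`, and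
`Θ (p, 0) = 0`. [folklore] -/
theorem rc_arcTheta :
    (∀ q : F × EuclideanSpace ℝ (Fin 2), ‖m q.1 * cx q.2‖ < s₀ → rc (Θ q) = m q.1 * cx q.2) ∧
    ∀ p : F, Θ (p, 0) = 0 := by
  constructor
  · intro q hq
    rw [hΘ, rc_R hδ hs₀ hR hrc hq]
  · intro p
    have h0 : m p * cx 0 = 0 := by
      rw [mul_eq_zero]; right; rw [hcx]; apply Complex.ext <;> simp
    rw [hΘ]
    simp only
    rw [h0, hR]
    simp

include hcx hO hm in
/-- `W = {q | q.1 ∈ O, ‖m q.1 · cx q.2‖ < s₀}` is open. [folklore] -/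
theorem isOpen_arcW : IsOpen {q : F × EuclideanSpace ℝ (Fin 2) | q.1 ∈ O ∧ ‖m q.1 * cx q.2‖ < s₀} := by
  have hc : ContinuousOn (fun q : F × EuclideanSpace ℝ (Fin 2) => ‖m q.1 * cx q.2‖)
      (O ×ˢ (univ : Set _)) := (contMDiffOn_mul_cx hcx hm).continuousOn.norm
  have h := hc.isOpen_inter_preimage (hO.prod isOpen_univ) (isOpen_Iio (a := s₀))
  have heq : {q : F × EuclideanSpace ℝ (Fin 2) | q.1 ∈ O ∧ ‖m q.1 * cx q.2‖ < s₀} =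
      O ×ˢ (univ : Set _) ∩ (fun q : F × EuclideanSpace ℝ (Fin 2) => ‖m q.1 * cx q.2‖) ⁻¹' Iio s₀ := by
    ext q; simp [mem_prod]
  rw [heq]; exact h

omit [ChartedSpace (EuclideanSpace ℝ (Fin 2)) F] in
include hrc hδ hδ1 hO in
/-- `W′ = {q | q.1 ∈ O, ‖rc q.2‖ < s₀}` is open. [folklore] -/
theorem isOpen_arcW' : IsOpen {q : F × EuclideanSpace ℝ (Fin 2) | q.1 ∈ O ∧ ‖rc q.2‖ < s₀} := by
  have hc : Continuous (fun q : F × EuclideanSpace ℝ (Fin 2) => ‖rc q.2‖) :=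
    ((contMDiff_rc hδ hδ1 hrc).continuous.comp continuous_snd).norm
  exact (hO.preimage continuous_fst).inter (isOpen_lt hc continuous_const)

include hcx hm hR hδ hs₀ hΘ in
/-- The thin-arc profile is smooth on `W`. [folklore] -/
theorem contMDiffOn_arcTheta :
    ContMDiffOn ((𝓡 2).prod (𝓡 2)) (𝓡 2) ∞ Θ
      {q : F × EuclideanSpace ℝ (Fin 2) | q.1 ∈ O ∧ ‖m q.1 * cx q.2‖ < s₀} := by
  intro q hq
  have h1 : ContMDiffWithinAt ((𝓡 2).prod (𝓡 2)) 𝓘(ℝ, ℂ) ∞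
      (fun q : F × EuclideanSpace ℝ (Fin 2) => m q.1 * cx q.2)
      {q : F × EuclideanSpace ℝ (Fin 2) | q.1 ∈ O ∧ ‖m q.1 * cx q.2‖ < s₀} q :=
    (contMDiffOn_mul_cx hcx hm q ⟨hq.1, mem_univ _⟩).mono fun q hq => ⟨hq.1, mem_univ _⟩
  have h2 := (contDiffAt_R hδ hs₀ hR hq.2).comp_contMDiffWithinAt
    (f := fun q : F × EuclideanSpace ℝ (Fin 2) => m q.1 * cx q.2) h1
  have heq : Θ = R ∘ fun q : F × EuclideanSpace ℝ (Fin 2) => m q.1 * cx q.2 := funext hΘ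
  rw [heq]; exact h2

include hvc hm hm0 hrc hδ hδ1 hΛ in
/-- The inverse thin-arc profile is smooth on `O × ℝ²` (hence on `W′`). [folklore] -/
theorem contMDiffOn_arcLambda :
    ContMDiffOn ((𝓡 2).prod (𝓡 2)) (𝓡 2) ∞ Λ (O ×ˢ (univ : Set _)) := by
  have h1 : ContMDiffOn ((𝓡 2).prod (𝓡 2)) 𝓘(ℝ, ℂ) ∞
      (fun q : F × EuclideanSpace ℝ (Fin 2) => (m q.1)⁻¹) (O ×ˢ (univ : Set _)) :=
    (contMDiffOn_inv hm0 hm).comp contMDiffOn_fst fun q hq => hq.1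
  have h2 : ContMDiff ((𝓡 2).prod (𝓡 2)) 𝓘(ℝ, ℂ) ∞
      (fun q : F × EuclideanSpace ℝ (Fin 2) => rc q.2) :=
    (contMDiff_rc hδ hδ1 hrc).comp contMDiff_snd
  have h3 : ContMDiffOn ((𝓡 2).prod (𝓡 2)) 𝓘(ℝ, ℂ) ∞
      (fun q : F × EuclideanSpace ℝ (Fin 2) => (m q.1)⁻¹ * rc q.2) (O ×ˢ (univ : Set _)) :=
    (contDiff_mul (𝕜 := ℝ) (𝔸 := ℂ)).contMDiff.comp_contMDiffOn (h1.prodMk_space h2.contMDiffOn)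
  have heq : Λ = vc ∘ fun q : F × EuclideanSpace ℝ (Fin 2) => (m q.1)⁻¹ * rc q.2 := funext hΛ
  rw [heq]; exact (NeckPiece.contMDiff_vc hvc).comp_contMDiffOn h3

include hcx hT hm hR hδ hs₀ hΘ in
/-- **The thin-arc far piece `(p, ṽ) ↦ T (p, R (m p · cx ṽ))` is smooth on `W`.** [folklore] -/
theorem contMDiffOn_arcFar :
    ContMDiffOn ((𝓡 2).prod (𝓡 2)) (𝓡 4) ∞
      (fun q : F × EuclideanSpace ℝ (Fin 2) => T (q.1, Θ q))
      {q : F × EuclideanSpace ℝ (Fin 2) | q.1 ∈ O ∧ ‖m q.1 * cx q.2‖ < s₀} :=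
  Reparam.contMDiffOn_reparam hT (contMDiffOn_arcTheta hcx hm hδ hs₀ hR hΘ)

include hcx hvc hT hm0 hR hrc hδ hδ1 hs₀ hΘ hΛ in
/-- The thin-arc far piece is injective on `W`. [folklore] -/
theorem injOn_arcFar :
    InjOn (fun q : F × EuclideanSpace ℝ (Fin 2) => T (q.1, Θ q))
      {q : F × EuclideanSpace ℝ (Fin 2) | q.1 ∈ O ∧ ‖m q.1 * cx q.2‖ < s₀} :=
  Reparam.injOn_reparam hT.isEmbedding.injective
    (arc_identities hcx hvc hm0 hδ hδ1 hs₀ hR hrc hΘ hΛ).2.1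

include hcx hvc hT hTo hO hm hm0 hR hrc hδ hδ1 hs₀ hΘ hΛ in
/-- The thin-arc far piece maps open subsets of `W` to open sets. [folklore] -/
theorem isOpen_image_arcFar {Oq : Set (F × EuclideanSpace ℝ (Fin 2))} (hOq : IsOpen Oq)
    (hOqW : Oq ⊆ {q : F × EuclideanSpace ℝ (Fin 2) | q.1 ∈ O ∧ ‖m q.1 * cx q.2‖ < s₀}) :
    IsOpen ((fun q : F × EuclideanSpace ℝ (Fin 2) => T (q.1, Θ q)) '' Oq) := by
  obtain ⟨hΘW, hΛΘ, -, hΘΛ⟩ := arc_identities hcx hvc hm0 hδ hδ1 hs₀ hR hrc hΘ hΛ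
  exact Reparam.isOpen_image_reparam hT hTo (isOpen_arcW' hO hδ hδ1 hrc)
    ((contMDiffOn_arcLambda hvc hm hm0 hδ hδ1 hrc hΛ).mono fun q hq => ⟨hq.1, mem_univ _⟩)
    hΘW hΛΘ hΘΛ hOq hOqW

include hcx hvc hT hm hm0 hR hrc hδ hδ1 hs₀ hΘ hΛ in
/-- The thin-arc far piece has a smooth left inverse on its image. [folklore] -/
theorem exists_inverse_arcFar [Nonempty F] :
    ∃ Rinv : X → F × EuclideanSpace ℝ (Fin 2),
      ContMDiffOn (𝓡 4) ((𝓡 2).prod (𝓡 2)) ∞ Rinv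
        ((fun q : F × EuclideanSpace ℝ (Fin 2) => T (q.1, Θ q)) ''
          {q : F × EuclideanSpace ℝ (Fin 2) | q.1 ∈ O ∧ ‖m q.1 * cx q.2‖ < s₀}) ∧
      ∀ q ∈ {q : F × EuclideanSpace ℝ (Fin 2) | q.1 ∈ O ∧ ‖m q.1 * cx q.2‖ < s₀},
        Rinv (T (q.1, Θ q)) = q := by
  obtain ⟨hΘW, hΛΘ, -, -⟩ := arc_identities hcx hvc hm0 hδ hδ1 hs₀ hR hrc hΘ hΛ
  exact Reparam.exists_inverse_reparam hT
    ((contMDiffOn_arcLambda hvc hm hm0 hδ hδ1 hrc hΛ).mono fun q hq => ⟨hq.1, mem_univ _⟩)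
    hΘW hΛΘ

end Arc

end FibreProfile

end Literature.Topology.FourManifolds
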